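import Summits.KontsevichZagierPeriods.KontsevichZagierPeriods.Theorems.LinRedNormalFormHoffmanSpanInKZFastAcc

/-!
# Crux `LinRedNormalForm.HoffmanSpanInKZ` (stmt-KontsevichZagierPeriods-15044), line `Sketch`:
# FAST mod-`p` transcript checkers — rows, tables, soundness, assembly (registered stub `stub_fastCert`)

The derived-row / word-row checkers of the mod-`p` transcript format (rows `DRowP` / `WRowP` of
`LinRedNormalFormHoffmanSpanInKZModTables`) run on word CODES with natural-number arithmetic modulo `p`
(`LinRedNormalFormHoffmanSpanInKZFastAcc`): `drowOkC` / `dtableOkC` (generator side conditions, admissible support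
and encoding round trip checked; accumulator `−V + g + Σ c_k V_k` empty), `wrowOkC` / `wtableOkC`; soundness into
`spanP p N` (`mem_spanP_of_dtableOkC`, `uP_mem_spanP_of_wtableOkC`) and the assembly `edsCertificate_of_ctables`
through `edsCertificate_of_unitP`.  The claimed vectors are kept
in a BLOCKED memory (`pushB` / `getB`, blocks of `32`, cited by flat index) so that a citation costs `O(k/32 + 32)` list
steps instead of `O(k)`.  Measured: `≈ 1 ms` of kernel time per merge step (the `ZMod`/`List Bool` checkers:
`≈ 7 ms`), and no recursion-depth failures on the weight-`11` core rows.

Sources: the reflection set-up of the Derived / ModTables files (this tree). [folklore]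
-/

namespace Summit.KontsevichZagierPeriods.LinRedNormalForm.HoffmanSpanInKZ

open Literature.NumberTheory.Transcendental
open Summit.KontsevichZagierPeriods.MzvKernelInKZ.Negative
open Summit.KontsevichZagierPeriods.MzvKernelInKZ.TwoPosets
open Submodule

/-! ## Blocked memory: the claimed vectors in blocks of `32`, cited by flat index -/

/-- Push a vector onto a blocked memory (blocks of at most `32`; a new block when the last one is full). [folklore] -/
def pushB : List (List (List (ℕ × ℕ))) → List (ℕ × ℕ) → List (List (List (ℕ × ℕ)))
  | [], v => [[v]]
  | [b], v => bif Nat.blt b.length 32 then [b ++ [v]] else [b, [v]]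
  | b :: b' :: bs, v => b :: pushB (b' :: bs) v

/-- Push a list of vectors, in order. [folklore] -/
def pushAllB (mem : List (List (List (ℕ × ℕ)))) (vs : List (List (ℕ × ℕ))) : List (List (List (ℕ × ℕ))) :=
  vs.foldl pushB mem

/-- Fetch the vector with flat index `k` (block `k / 32`, offset `k % 32`; the empty combination if absent):
`O(k / 32 + 32)` steps instead of `O(k)`. [folklore] -/
def getB (mem : List (List (List (ℕ × ℕ)))) (k : ℕ) : List (ℕ × ℕ) := (mem.getD (k / 32) []).getD (k % 32) []

section MemB

variable {p N : ℕ}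

/-- The empty memory is fine. [folklore] -/
theorem memOk_nil : ∀ b ∈ ([] : List (List (List (ℕ × ℕ)))), ∀ v ∈ b, evalC p N v ∈ spanP p N :=
  fun b hb => by simp at hb

/-- Pushing a good vector keeps the memory fine. [folklore] -/
theorem memOk_pushB : ∀ (mem : List (List (List (ℕ × ℕ)))) (v : List (ℕ × ℕ)),
    (∀ b ∈ mem, ∀ w ∈ b, evalC p N w ∈ spanP p N) → evalC p N v ∈ spanP p N →
      ∀ b ∈ pushB mem v, ∀ w ∈ b, evalC p N w ∈ spanP p N
  | [], v, _, hv => fun b hb w hw => by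
    simp only [pushB, List.mem_singleton] at hb
    subst hb
    simp only [List.mem_singleton] at hw
    subst hw
    exact hv
  | [b], v, hm, hv => by
    unfold pushB
    cases Nat.blt b.length 32 <;> simp only [cond_true, cond_false] <;> intro b' hb' w hw
    · rcases List.mem_cons.1 hb' with rfl | hb'
      · exact hm _ (by simp) w hw
      · simp only [List.mem_singleton] at hb'
        subst hb'
        simp only [List.mem_singleton] at hw
        subst hw
        exact hv
    · simp only [List.mem_singleton] at hb'
      subst hb'
      rcases List.mem_append.1 hw with hw | hw
      · exact hm b (by simp) w hw
      · simp only [List.mem_singleton] at hw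
        subst hw
        exact hv
  | b :: b' :: bs, v, hm, hv => by
    intro c hc w hw
    rw [pushB] at hc
    rcases List.mem_cons.1 hc with rfl | hc
    · exact hm _ (by simp) w hw
    · exact memOk_pushB (b' :: bs) v (fun d hd => hm d (List.mem_cons_of_mem _ hd)) hv c hc w hw

/-- Pushing good vectors keeps the memory fine. [folklore] -/
theorem memOk_pushAllB (mem : List (List (List (ℕ × ℕ)))) (vs : List (List (ℕ × ℕ)))
    (hm : ∀ b ∈ mem, ∀ w ∈ b, evalC p N w ∈ spanP p N) (hvs : ∀ v ∈ vs, evalC p N v ∈ spanP p N) :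
    ∀ b ∈ pushAllB mem vs, ∀ w ∈ b, evalC p N w ∈ spanP p N := by
  induction vs generalizing mem with
  | nil => simpa [pushAllB] using hm
  | cons v vs ih =>
    rw [pushAllB, List.foldl_cons]
    exact ih (pushB mem v) (memOk_pushB mem v hm (hvs v (by simp))) fun w hw => hvs w (by simp [hw])

/-- A fetched vector realises inside `spanP`. [folklore] -/
theorem evalC_getB_mem (mem : List (List (List (ℕ × ℕ)))) (hm : ∀ b ∈ mem, ∀ w ∈ b, evalC p N w ∈ spanP p N)
    (k : ℕ) :
    evalC p N (getB mem k) ∈ spanP p N := by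
  unfold getB
  rw [List.getD_eq_getElem?_getD, List.getD_eq_getElem?_getD]
  cases hb : mem[k / 32]? with
  | none => simp
  | some b =>
    simp only [Option.getD_some]
    cases hv : b[k % 32]? with
    | none => simp
    | some v => simpa using hm b (List.mem_of_getElem? hb) v (List.mem_of_getElem? hv)

/-- Cited combinations fetched from a fine memory lie in `spanP`. [folklore] -/
theorem sum_citesB_mem_spanP (mem : List (List (List (ℕ × ℕ))))
    (hm : ∀ b ∈ mem, ∀ w ∈ b, evalC p N w ∈ spanP p N) (f : ℕ → ZMod p)
    (L : List (ℕ × ℕ)) : (L.map fun q => f q.2 • evalC p N (getB mem q.1)).sum ∈ spanP p N := by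
  refine list_sum_mem fun x hx => ?_
  obtain ⟨q, _, rfl⟩ := List.mem_map.1 hx
  exact smul_mem _ _ (evalC_getB_mem mem hm q.1)

end MemB

/-! ## The checkers -/

/-- The claimed vector of a row as a code combination (coefficients reduced). [folklore] -/
def DRowP.cvec (p : ℕ) (d : DRowP) : List (ℕ × ℕ) := d.V.map fun q => (q.1, q.2 % p)

/-- Its realisation is that of `DRowP.vvec`. [folklore] -/
theorem evalC_cvec (p N : ℕ) (d : DRowP) : evalC p N (d.cvec p) = evalG (ZMod p) N (d.vvec p N) := by
  unfold DRowP.cvec DRowP.vvec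
  induction d.V with
  | nil => simp
  | cons q V ih => rw [List.map_cons, List.map_cons, evalC_cons, evalG_cons, ih, ZMod.natCast_mod]

/-- Fast accumulator of a derived row: `−V`, the encoded generator inserted, the citations merged. [folklore] -/
def DRowP.accC (p N : ℕ) (mem : List (List (List (ℕ × ℕ)))) (d : DRowP) : List (ℕ × ℕ) :=
  foldMergeC p (getB mem) false d.L (foldInsC p (d.g.fvecC p N) (d.V.map fun q => (q.1, (p - q.2 % p) % p)))

/-- Fast derived-row checker. [folklore] -/
def drowOkC (p N : ℕ) (mem : List (List (List (ℕ × ℕ)))) (d : DRowP) : Bool :=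
  d.g.ok N && admOk N (d.g.fvecZ N) && codeOk N d.g && (d.accC p N mem).isEmpty

/-- Fast derived-table checker, threading the blocked memory of claimed vectors. [folklore] -/
def dtableOkC (p N : ℕ) : List (List (List (ℕ × ℕ))) → List DRowP → Bool
  | _, [] => true
  | mem, d :: ds => drowOkC p N mem d && dtableOkC p N (pushB mem (d.cvec p)) ds

section Sound

variable {p N : ℕ}

/-- The negated claimed vector realises to `−V`. [folklore] -/
theorem evalC_negV (hp : 0 < p) (V : List (ℕ × ℕ)) :
    evalC p N (V.map fun q => (q.1, (p - q.2 % p) % p)) = -evalC p N (V.map fun q => (q.1, q.2 % p)) := by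
  induction V with
  | nil => simp
  | cons q V ih =>
    rw [List.map_cons, List.map_cons, evalC_cons, evalC_cons, ih, cast_neg_mod hp, ZMod.natCast_mod, neg_smul,
      neg_add]

/-- An empty accumulator realises to `0`. [folklore] -/
theorem evalC_eq_zero_of_isEmpty {v : List (ℕ × ℕ)} (h : v.isEmpty = true) : evalC p N v = 0 := by
  rw [List.isEmpty_iff] at h
  subst h
  rfl

/-- **Soundness of one fast derived row** (for `0 < p`). [folklore] -/
theorem mem_spanP_of_drowOkC (hp : 0 < p) (mem : List (List (List (ℕ × ℕ))))
    (hmem : ∀ b ∈ mem, ∀ w ∈ b, evalC p N w ∈ spanP p N) (d : DRowP)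
    (h : drowOkC p N mem d = true) : evalC p N (d.cvec p) ∈ spanP p N := by
  simp only [drowOkC, Bool.and_eq_true] at h
  obtain ⟨⟨⟨hg, ha⟩, hc⟩, hz⟩ := h
  have h0 := evalC_eq_zero_of_isEmpty (p := p) (N := N) hz
  rw [DRowP.accC, evalC_foldMergeC, evalC_foldInsC, evalC_negV hp, ← DRowP.cvec, evalC_fvecC hp d.g hc] at h0
  have h1 : evalC p N (d.cvec p) =
      (d.L.map fun q => ((citeC p false q.2 : ℕ) : ZMod p) • evalC p N (getB mem q.1)).sum +
        evalG (ZMod p) N (d.g.fvecP p N) := by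
    rw [← sub_eq_zero, ← neg_eq_zero, ← h0]; abel
  rw [h1]
  exact add_mem (sum_citesB_mem_spanP mem hmem (fun n => ((citeC p false n : ℕ) : ZMod p)) d.L)
    (evalG_fvecP_mem_spanP d.g hg ha)

/-- **Soundness of the fast derived-table checker**: from a fine memory, every claimed vector of a checked table
realises in `spanP`, and the final memory is fine. [folklore] -/
theorem memOk_of_dtableOkC (hp : 0 < p) :
    ∀ (T : List DRowP) (mem : List (List (List (ℕ × ℕ)))), (∀ b ∈ mem, ∀ w ∈ b, evalC p N w ∈ spanP p N) →
      dtableOkC p N mem T = true →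
        (∀ b ∈ pushAllB mem (T.map (DRowP.cvec p)), ∀ w ∈ b, evalC p N w ∈ spanP p N) ∧
          ∀ d ∈ T, evalC p N (d.cvec p) ∈ spanP p N := by
  intro T
  induction T with
  | nil => intro mem hmem _; exact ⟨by simpa [pushAllB] using hmem, fun d hd => by simp at hd⟩
  | cons d T ih =>
    intro mem hmem h
    simp only [dtableOkC, Bool.and_eq_true] at h
    obtain ⟨hd, hT⟩ := h
    have hdv := mem_spanP_of_drowOkC hp mem hmem d hd
    obtain ⟨h1, h2⟩ := ih (pushB mem (d.cvec p)) (memOk_pushB mem _ hmem hdv) hT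
    refine ⟨by simpa [pushAllB] using h1, fun d' hd' => ?_⟩
    rcases List.mem_cons.1 hd' with rfl | hd'
    exacts [hdv, h2 d' hd']

/-- Splitting a fast derived-table check at an append. [folklore] -/
theorem dtableOkC_append :
    ∀ (A B : List DRowP) (mem : List (List (List (ℕ × ℕ)))), dtableOkC p N mem A = true →
      dtableOkC p N (pushAllB mem (A.map (DRowP.cvec p))) B = true → dtableOkC p N mem (A ++ B) = true := by
  intro A
  induction A with
  | nil => intro B mem _ h; simpa [pushAllB] using h
  | cons d A ih =>
    intro B mem h₁ h₂
    simp only [dtableOkC, List.cons_append, Bool.and_eq_true] at h₁ ⊢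
    refine ⟨h₁.1, ih B (pushB mem (d.cvec p)) h₁.2 ?_⟩
    simpa [pushAllB] using h₂

end Sound

/-! ## Word rows -/

/-- Fast accumulator of a word row: `e_w`, cited words and encoded Hoffman words inserted negated, cited derived
vectors merged negated. [folklore] -/
def WRowP.accC (p : ℕ) (dv : List (List (List (ℕ × ℕ)))) (c : WRowP) : List (ℕ × ℕ) :=
  foldMergeC p (getB dv) true c.E
    (foldInsC p ((c.P.map fun q => (q.1, (p - q.2 % p) % p)) ++
        (c.H.map fun q => (codeOfWord (MZV.binaryWord q.1), (p - q.2 % p) % p))) [(c.w, 1 % p)])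

/-- Fast word-row checker: Hoffman side conditions with the encoding round trip checked, citations among the
certified codes, empty accumulator. [folklore] -/
def wrowOkC (p N : ℕ) (dv : List (List (List (ℕ × ℕ)))) (prev : List ℕ) (c : WRowP) : Bool :=
  decide (∀ q ∈ c.H, MZV.IsHoffman q.1 ∧ MZV.weight q.1 = N ∧ Adm (bword N q.1) ∧
    wordOf N (wordOfCode N (codeOfWord (MZV.binaryWord q.1))) = bword N q.1) &&
  c.P.all (fun q => prev.contains q.1) && (c.accC p dv).isEmpty

/-- Fast word-table checker. [folklore] -/
def wtableOkC (p N : ℕ) (dv : List (List (List (ℕ × ℕ)))) : List ℕ → List WRowP → Bool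
  | _, [] => true
  | prev, c :: T => wrowOkC p N dv prev c && wtableOkC p N dv (c.w :: prev) T

section WSound

variable {p N : ℕ}

/-- **Soundness of one fast word row** (for `1 < p`). [folklore] -/
theorem uP_mem_spanP_of_wrowOkC (hp : 1 < p) (dv : List (List (List (ℕ × ℕ))))
    (hdv : ∀ b ∈ dv, ∀ w ∈ b, evalC p N w ∈ spanP p N) (prev : List ℕ) (hprev : ∀ c ∈ prev, uP p N c ∈ spanP p N) (c : WRowP) (h : wrowOkC p N dv prev c = true) :
    uP p N c.w ∈ spanP p N := by
  have hp0 : 0 < p := lt_trans Nat.zero_lt_one hp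
  simp only [wrowOkC, Bool.and_eq_true, decide_eq_true_eq, List.all_eq_true] at h
  obtain ⟨⟨hH, hP⟩, hz⟩ := h
  have h0 := evalC_eq_zero_of_isEmpty (p := p) (N := N) hz
  rw [WRowP.accC, evalC_foldMergeC, evalC_foldInsC, evalC_append, evalC_cons, evalC_nil] at h0
  -- the inserted lists are negations
  have eP : evalC p N (c.P.map fun q => (q.1, (p - q.2 % p) % p)) =
      -(c.P.map fun q => ((q.2 : ℕ) : ZMod p) • uP p N q.1).sum := by
    induction c.P with
    | nil => simp
    | cons q P ih => rw [List.map_cons, List.map_cons, evalC_cons, List.sum_cons, ih, cast_neg_mod hp0, neg_add,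
        neg_smul, uP]
  have eH : evalC p N (c.H.map fun q => (codeOfWord (MZV.binaryWord q.1), (p - q.2 % p) % p)) =
      -(c.H.map fun q => ((q.2 : ℕ) : ZMod p) • (Pi.single (wordOf N (wordOfCode N (codeOfWord
        (MZV.binaryWord q.1)))) (1 : ZMod p) : (Fin N → Bool) → ZMod p)).sum := by
    induction c.H with
    | nil => simp
    | cons q H ih => rw [List.map_cons, List.map_cons, evalC_cons, List.sum_cons, ih, cast_neg_mod hp0, neg_add,
        neg_smul]
  have eE : (c.E.map fun q => ((citeC p true q.2 : ℕ) : ZMod p) • evalC p N (getB dv q.1)).sum =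
      -(c.E.map fun q => ((q.2 : ℕ) : ZMod p) • evalC p N (getB dv q.1)).sum := by
    induction c.E with
    | nil => simp
    | cons q E ih => rw [List.map_cons, List.map_cons, List.sum_cons, List.sum_cons, ih, cast_citeC hp0, cond_true,
        neg_smul, neg_add]
  have h1p : ((1 % p : ℕ) : ZMod p) = 1 := by rw [Nat.mod_eq_of_lt hp, Nat.cast_one]
  rw [eP, eH, eE, h1p, one_smul, add_zero] at h0
  have h1 : uP p N c.w = (c.E.map fun q => ((q.2 : ℕ) : ZMod p) • evalC p N (getB dv q.1)).sum +
      ((c.P.map fun q => ((q.2 : ℕ) : ZMod p) • uP p N q.1).sum +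
        (c.H.map fun q => ((q.2 : ℕ) : ZMod p) • (Pi.single (wordOf N (wordOfCode N (codeOfWord
          (MZV.binaryWord q.1)))) (1 : ZMod p) : (Fin N → Bool) → ZMod p)).sum) := by
    rw [← sub_eq_zero, ← h0, uP]; abel
  rw [h1]
  refine add_mem (sum_citesB_mem_spanP dv hdv (fun n => ((n : ℕ) : ZMod p)) c.E) (add_mem ?_ ?_)
  · refine list_sum_mem fun x hx => ?_
    obtain ⟨q, hq, rfl⟩ := List.mem_map.1 hx
    exact smul_mem _ _ (hprev q.1 (List.contains_iff_mem.1 (hP q hq)))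
  · refine list_sum_mem fun x hx => ?_
    obtain ⟨q, hq, rfl⟩ := List.mem_map.1 hx
    obtain ⟨h1, h2, h3, h4⟩ := hH q hq
    rw [h4]
    exact smul_mem _ _ (single_bword_mem_spanP q.1 h1 h2 h3)

/-- **Soundness of the fast word-table checker.** [folklore] -/
theorem uP_mem_spanP_of_wtableOkC (hp : 1 < p) (dv : List (List (List (ℕ × ℕ))))
    (hdv : ∀ b ∈ dv, ∀ w ∈ b, evalC p N w ∈ spanP p N) :
    ∀ (T : List WRowP) (prev : List ℕ), (∀ c ∈ prev, uP p N c ∈ spanP p N) →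
      wtableOkC p N dv prev T = true → ∀ c ∈ T, uP p N c.w ∈ spanP p N := by
  intro T
  induction T with
  | nil => intro _ _ _ c hc; simp at hc
  | cons c T ih =>
    intro prev hprev h c' hc'
    simp only [wtableOkC, Bool.and_eq_true] at h
    obtain ⟨hc, hT⟩ := h
    have hcw := uP_mem_spanP_of_wrowOkC hp dv hdv prev hprev c hc
    rcases List.mem_cons.1 hc' with rfl | hmem
    · exact hcw
    · refine ih (c.w :: prev) ?_ hT c' hmem
      intro w hw
      rcases List.mem_cons.1 hw with rfl | hw'
      exacts [hcw, hprev w hw']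

/-- Splitting a fast word-table check at an append. [folklore] -/
theorem wtableOkC_append (dv : List (List (List (ℕ × ℕ)))) :
    ∀ (T₁ T₂ : List WRowP) (prev : List ℕ),
      wtableOkC p N dv prev T₁ = true → wtableOkC p N dv ((T₁.map WRowP.w).reverse ++ prev) T₂ = true →
        wtableOkC p N dv prev (T₁ ++ T₂) = true := by
  intro T₁
  induction T₁ with
  | nil => intro T₂ prev _ h; simpa using h
  | cons c T₁ ih =>
    intro T₂ prev h₁ h₂
    simp only [wtableOkC, List.cons_append, Bool.and_eq_true] at h₁ ⊢
    refine ⟨h₁.1, ih T₂ (c.w :: prev) h₁.2 ?_⟩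
    simpa [List.map_cons, List.reverse_cons, List.append_assoc] using h₂

end WSound

/-! ## Assembly -/

/-- **From fast-checked mod-`p` tables to `EdsCertificate N`.** [folklore] -/
theorem edsCertificate_of_ctables (p N : ℕ) [hp : Fact p.Prime] (Δ : List DRowP) (T : List WRowP)
    (hΔ : dtableOkC p N [] Δ = true) (hT : wtableOkC p N (pushAllB [] (Δ.map (DRowP.cvec p))) [] T = true)
    (hcover : (allWords N).all (fun l => decide (Adm (wordOf N l) → l ∈ T.map fun c => wordOfCode N c.w)) =
      true) : EdsCertificate N := by
  have hdv := (memOk_of_dtableOkC hp.out.pos Δ [] memOk_nil hΔ).1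
  have hT' := uP_mem_spanP_of_wtableOkC hp.out.one_lt _ hdv T [] (fun c hc => by simp at hc) hT
  refine edsCertificate_of_unitP p N fun ε hε => ?_
  have hl : List.ofFn ε ∈ allWords N := by simpa using mem_allWords (List.ofFn ε)
  have := of_decide_eq_true ((List.all_eq_true.1 hcover) _ hl)
  rw [wordOf_ofFn] at this
  obtain ⟨c, hc, hcw⟩ := List.mem_map.1 (this hε)
  have hu := hT' c hc
  rwa [uP, hcw, wordOf_ofFn] at hu

/-! ## The registered stub -/

/-- Soundness of fast-checked mod-`p` transcripts, as a statement about this file's checkers (not a published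
fact). -/
def FastCertSound : Prop :=
  ∀ (p N : ℕ) [Fact p.Prime] (Δ : List DRowP) (T : List WRowP), dtableOkC p N [] Δ = true →
    wtableOkC p N (pushAllB [] (Δ.map (DRowP.cvec p))) [] T = true →
      (allWords N).all (fun l => decide (Adm (wordOf N l) → l ∈ T.map fun c => wordOfCode N c.w)) = true →
        EdsCertificate N

/-- **Registered stub `stub_fastCert`** of the skeleton of line `Sketch`. -/
theorem stub_fastCert : FastCertSound := fun p N _ Δ T h₁ h₂ h₃ => edsCertificate_of_ctables p N Δ T h₁ h₂ h₃

/-! ## Smoke test (kernel), weight `4`, modulo `65521` -/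

example : dtableOkC 65521 4 []
    [⟨.F [2] [2], [], [(1, 65520), (3, 4)]⟩,
     ⟨.D [3], [(0, 49141)], [(1, 16381), (5, 65520)]⟩,
     ⟨.K [2, 1, 1], [], [(1, 65520), (7, 1)]⟩] = true := by
  decide +kernel

example : wtableOkC 65521 4 (pushAllB [] ([⟨.F [2] [2], [], [(1, 65520), (3, 4)]⟩,
     ⟨.D [3], [(0, 49141)], [(1, 16381), (5, 65520)]⟩,
     ⟨.K [2, 1, 1], [], [(1, 65520), (7, 1)]⟩].map (DRowP.cvec 65521))) []
    [⟨5, [], [([2, 2], 1)], []⟩,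
     ⟨1, [], [([2, 2], 43682)], [(1, 43682)]⟩,
     ⟨3, [(1, 49141)], [], [(0, 49141)]⟩,
     ⟨7, [(1, 1)], [], [(2, 1)]⟩] = true := by
  decide +kernel

end Summit.KontsevichZagierPeriods.LinRedNormalForm.HoffmanSpanInKZ
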